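import Literature.Analysis.FunctionSpaces.HolderManifoldCompactness
import Literature.Analysis.FunctionSpaces.HolderManifoldMollify
import HarnessLib

/-!
# Surjectivity onto `C^{0,r}_𝔄` from an a-priori estimate and smooth solvability (Hölder spaces, part 22)

Topic `Literature/Analysis/FunctionSpaces`. The classical passage from `C^∞` solvability to
`C^{0,α}` solvability for a second-order operator on a closed manifold
(Gilbarg–Trudinger 2001, proof of Theorem 6.14 / §6.3 "approximation of the data and compactness";
Joyce 2007, Thm 1.4.1 ⇒ Thm 1.5.3): let `L : C^{k,r}_𝔄(M, F) →L C^{0,r}_𝔄(M, F)` be a bounded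
linear operator which

1. satisfies the a-priori (Schauder-type) estimate `‖u‖ ≤ C‖Lu‖`,
2. is solvable for smooth data (`f` smooth ⇒ `∃ u, Lu = f`), and
3. is *local of order `≤ k`*: `L uₙ → L v` pointwise whenever the derivatives of order `≤ k` of all
   chart pieces of `uₙ` converge uniformly to those of `v`;

then `L` is onto: approximate `f` uniformly by smooth `fₙ` with `‖fₙ‖_{0,r} ≤ C'‖f‖` (part 21),
solve `Luₙ = fₙ`, bound `‖uₙ‖_{k,r}` by the estimate, extract a `C^k`-convergent subsequence with a
limit `v ∈ C^{k,r}_𝔄` (Arzelà–Ascoli, part 18) and pass to the limit in `Luₙ = fₙ` pointwise.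

* `HolderManifoldFunction.surjective_of_estimate_of_smooth`.

This closes census item (2c) of `Literature.Geometry.Riemannian.gurskyViaclovsky_pathOpen_weighted_four`
modulo the Schauder estimate (2a). Everything is proved; no named facts.

## References

* D. Gilbarg, N. S. Trudinger, *Elliptic Partial Differential Equations of Second Order* (2001),
  §6.3, Lemma 6.36. [GilbargTrudinger2001]
* D. Joyce, *Riemannian Holonomy Groups and Calibrated Geometry* (2007), §1.4–1.5. [Joyce2007]
-/

noncomputable section

open Set Filter Metric Function
open scoped NNReal Topology Manifold ContDiff

namespace Literature.Analysis.FunctionSpaces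

variable {ι : Type*} [Fintype ι] {E : Type} [NormedAddCommGroup E] [NormedSpace ℝ E]
  [FiniteDimensional ℝ E] {M : Type*} [TopologicalSpace M] [ChartedSpace E M]
  [IsManifold 𝓘(ℝ, E) ∞ M] [CompactSpace M] [T2Space M] (𝔄 : HolderChartData ι E M)
  {F : Type} [NormedAddCommGroup F] [NormedSpace ℝ F] [FiniteDimensional ℝ F] {k : ℕ} {r : ℝ≥0}

/-- **Surjectivity onto `C^{0,r}_𝔄` from an a-priori estimate, smooth solvability and locality.**
See the module docstring. [cite: GilbargTrudinger2001, §6.3, Lemma 6.36] -/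
theorem HolderManifoldFunction.surjective_of_estimate_of_smooth (hr0 : 0 < r) (hr : r ≤ 1)
    (L : HolderManifoldFunction 𝔄 F k r →L[ℝ] HolderManifoldFunction 𝔄 F 0 r) {C : ℝ}
    (hest : ∀ u, ‖u‖ ≤ C * ‖L u‖)
    (hsmooth : ∀ f : HolderManifoldFunction 𝔄 F 0 r, ContMDiff 𝓘(ℝ, E) 𝓘(ℝ, F) ∞ (f : M → F) →
      ∃ u, L u = f)
    (hloc : ∀ (u : ℕ → HolderManifoldFunction 𝔄 F k r) (v : HolderManifoldFunction 𝔄 F k r),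
      (∀ (i : ι) (j : ℕ), j ≤ k →
        TendstoUniformly (fun n => iteratedFDeriv ℝ j (𝔄.piece (u n : M → F) i))
          (iteratedFDeriv ℝ j (𝔄.piece (v : M → F) i)) atTop) →
      ∀ x, Tendsto (fun n => L (u n) x) atTop (𝓝 (L v x))) :
    Function.Surjective L := by
  haveI : CompleteSpace F := FiniteDimensional.complete ℝ F
  intro f
  obtain ⟨δ, hδ, C', happrox⟩ := HolderManifoldFunction.exists_smooth_approx 𝔄 (F := F) hr
  -- scales `ε_n = δ/(n+1)` and smooth approximants
  set ε : ℕ → ℝ := fun n => δ / (n + 1) with hε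
  have hεpos : ∀ n, 0 < ε n := fun n => by rw [hε]; positivity
  have hεle : ∀ n, ε n ≤ δ := fun n => by
    rw [hε]
    exact div_le_self hδ.le (by linarith [(Nat.cast_nonneg n : (0 : ℝ) ≤ n)])
  choose g hgs hgn hgd using fun n => happrox f (ε n) (hεpos n) (hεle n)
  -- smooth solutions and their uniform bound
  choose u hu using fun n => hsmooth (g n) (hgs n)
  have hB : ∀ n, ‖u n‖ ≤ |C| * (C' * ‖f‖) := fun n => by
    have h1 := hest (u n)
    rw [hu n] at h1
    calc ‖u n‖ ≤ C * ‖g n‖ := h1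
      _ ≤ |C| * ‖g n‖ := mul_le_mul_of_nonneg_right (le_abs_self C) (norm_nonneg _)
      _ ≤ |C| * (C' * ‖f‖) := mul_le_mul_of_nonneg_left (hgn n) (abs_nonneg C)
  -- Arzelà–Ascoli (part 18)
  obtain ⟨φ, hφ, v, hconv, -⟩ :=
    HolderManifoldFunction.exists_subseq_tendstoUniformly_of_norm_le hr0 u hB
  refine ⟨v, HolderManifoldFunction.ext fun x => ?_⟩
  -- `L (u (φ n)) x → L v x` by locality
  have h1 : Tendsto (fun n => L (u (φ n)) x) atTop (𝓝 (L v x)) := hloc (fun n => u (φ n)) v hconv x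
  -- `L (u (φ n)) x = g (φ n) x → f x`
  have hε0 : Tendsto ε atTop (𝓝 0) := by
    have h := (tendsto_one_div_add_atTop_nhds_zero_nat).const_mul δ
    rw [mul_zero] at h
    refine h.congr fun n => ?_
    rw [hε, mul_one_div]
  have hεr : Tendsto (fun n => |C'| * ‖f‖ * ε (φ n) ^ (r : ℝ)) atTop (𝓝 0) := by
    have h2 : Tendsto (fun n => ε (φ n)) atTop (𝓝 0) := hε0.comp hφ.tendsto_atTop
    have h3 : Tendsto (fun n => ε (φ n) ^ (r : ℝ)) atTop (𝓝 0) := by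
      have h := h2.rpow_const (p := (r : ℝ)) (Or.inr (NNReal.coe_nonneg r))
      rwa [Real.zero_rpow (NNReal.coe_pos.2 hr0).ne'] at h
    simpa using h3.const_mul (|C'| * ‖f‖)
  have h2 : Tendsto (fun n => L (u (φ n)) x) atTop (𝓝 (f x)) := by
    have heq : (fun n => L (u (φ n)) x) = fun n => g (φ n) x := by
      funext n
      rw [hu]
    rw [heq, tendsto_iff_norm_sub_tendsto_zero]
    refine squeeze_zero (fun n => norm_nonneg _) (fun n => ?_) hεr
    refine (hgd (φ n) x).trans (mul_le_mul_of_nonneg_right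
      (mul_le_mul_of_nonneg_right (le_abs_self _) (norm_nonneg _)) ?_)
    exact Real.rpow_nonneg (hεpos _).le _
  exact tendsto_nhds_unique h1 h2

end Literature.Analysis.FunctionSpaces

end
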